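import Summits.ResolutionOfSingularities.ResolutionOfSingularities.Theorems.FrobeniusClosingSteerHorizonBaseChange
import Summits.ResolutionOfSingularities.ResolutionOfSingularities.Theorems.FrobeniusClosingSteerJacobianLengthEtale
import HarnessLib

/-!
# [OURS · L0 W4.1] K3ᴳ (F5c): `horizonBaseChange` — the `hK3G` binder of the hGW3 assembler UNCONDITIONALLY, the ℓ-comparison discharged by
# res-L0-w41-stub-3's LAST MILE `JacobianLength.length_quotient_span_derivation_le_of_unramified`
# (chain W4.1 `FrobeniusClosingSteer`, crux stmt-ResolutionOfSingularities-16345; K3ᴳ target `L/res-L0-w41-stub-2/K3G/K3G_target_signature.lean`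
# 8151858124874f54; `--supports … --as helper`)

HONEST FRAMING. OURS kernel (HIRONAKA-L librarian res-D-lib-1 gen 8). `…HorizonBaseChange` proved the K3ᴳ body modulo the ℓ-comparison in res-L0-w41-stub-2's
étale-local SPEC shape; res-L0-w41-stub-3 landed the ℓ-comparison in the UNRAMIFIED-LOCAL-HOM packaging (`…JacobianLengthEtale`: regular local rings of
characteristic 2, `𝔪S′ = 𝔪′`, equal dimension, finite separable residue extension, a dual 2-frame of `κ(Ŝ)`), which is exactly what `EtaleLift.LevelLift` +
`finite_isSeparable_residueField_range` + `GeomTwoBasis.exists_pFrame_completion_of_chart` deliver at level 0 of the tower. Hence: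
* `length_le_range_of_unramified` — the comparison clause at level 0 for any compatible injective family `jₘ : Tₘ → L′`;
* `horizon_cont_of_embeddings_holds` — all K3ᴳ continuation clauses, no hypothesis beyond the chain data;
* **`horizonBaseChange`** — the body of `K3GTarget.horizonBaseChange` VERBATIM, no binder: with I″ the hGW3 body follows for every `e ≥ 2` by
  `GeomAssembly.geomChain_false_of_pieces_all hI2 horizonBaseChange`.
Nothing here is a statement of H. Hironaka's manuscript [Hironaka2017]. AI-written; AI review is weaker than expert review. [folklore]
-/

set_option linter.dupNamespace false

noncomputable section

namespace Summit.ResolutionOfSingularities.ResolutionOfSingularities.Theorems.SwitchingDichotomy.EtaleTower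

open IsLocalRing Polynomial Literature.AlgebraicGeometry.Resolution
open Summit.ResolutionOfSingularities.ResolutionOfSingularities.Theorems.SwitchingDichotomy.EtaleLift
open Summit.ResolutionOfSingularities.ResolutionOfSingularities.Theorems.SwitchingDichotomy.QuadraticTransformLift
open Summit.ResolutionOfSingularities.ResolutionOfSingularities.Theorems.SwitchingDichotomy.SigmaTopLegality

/-- Finite separability of a residue extension, moved from Mathlib's residue-field algebra of a local map `R → S′` to the `toAlgebra` instance of
`κ(R → S′)` (the packaging of `JacobianLength.length_quotient_span_derivation_le_of_unramified`). [folklore] -/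
theorem residueField_finite_isSeparable_toAlgebra {R S' : Type} [CommRing R] [IsLocalRing R] [CommRing S'] [IsLocalRing S']
    [Algebra R S'] [IsLocalHom (algebraMap R S')]
    [hfin : Module.Finite (ResidueField R) (ResidueField S')] [hsep : Algebra.IsSeparable (ResidueField R) (ResidueField S')] :
    @Module.Finite (ResidueField R) (ResidueField S') _ _ (ResidueField.map (algebraMap R S')).toAlgebra.toModule ∧
      @Algebra.IsSeparable (ResidueField R) (ResidueField S') _ _ (ResidueField.map (algebraMap R S')).toAlgebra := by
  have he : (@algebraMap (ResidueField R) (ResidueField S') _ _ (ResidueField.map (algebraMap R S')).toAlgebra).comp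
      (RingEquiv.refl (ResidueField R)).toRingHom =
      (RingEquiv.refl (ResidueField S')).toRingHom.comp (algebraMap (ResidueField R) (ResidueField S')) := by
    refine RingHom.ext fun z => ?_
    obtain ⟨s, rfl⟩ := residue_surjective z
    change ResidueField.map (algebraMap R S') (residue R s) = algebraMap (ResidueField R) (ResidueField S') (residue R s)
    rw [ResidueField.map_residue, IsLocalRing.ResidueField.algebraMap_residue]
  exact ⟨@Module.Finite.of_equiv_equiv (ResidueField R) (ResidueField S') (ResidueField R) (ResidueField S') _ _ _ _ _
      (ResidueField.map (algebraMap R S')).toAlgebra (RingEquiv.refl _) (RingEquiv.refl _) he hfin,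
    @Algebra.IsSeparable.of_equiv_equiv (ResidueField R) (ResidueField S') (ResidueField R) (ResidueField S') _ _ _ _ _
      (ResidueField.map (algebraMap R S')).toAlgebra (RingEquiv.refl _) (RingEquiv.refl _) he hsep⟩

section Levels

variable {L : Type} [Field L] [CharP L 2] (S : ℕ → Subring L) [∀ m, IsLocalRing (S m)] (hdom : ∀ m, SubringDominates (S m) (S (m + 1)))
  (P : (S 0)[X]) {k' : Type} [Field k'] (ψ : ∀ m, ResidueField (S m) →+* k') (hψ : IsCompat S hdom ψ) (θ : k')
  (hθ₀ : P.eval₂ ((ψ 0).comp (residue (S 0))) θ = 0)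
  {L' : Type} [Field L'] (j : ∀ m, Localization.AtPrime (kerT S hdom P ψ hψ θ hθ₀ m) →+* L')
  (hjsucc : ∀ m, (j (m + 1)).comp (gT S hdom P ψ hψ θ hθ₀ m) = j m)

set_option maxHeartbeats 1600000 in
include hjsucc in
/-- **The ℓ-comparison clause at level 0** — `ℓ(Ŝ′₀ ⧸ 𝒥_abs f̂′₀) ≤ ℓ(Ŝ₀ ⧸ 𝒥_abs f̂₀)` for `S′ 0 := range j₀`, `f′₀ := φ₀ f₀` — by res-L0-w41-stub-3's
`JacobianLength.length_quotient_span_derivation_le_of_unramified` fed with `LevelLift` at level 0 (local, unramified, equal dimension, regular), the finite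
separable residue extension (`finite_isSeparable_residueField_range`) and the dual 2-frame of `κ(Ŝ₀)` of the geometric chart
(`GeomTwoBasis.exists_pFrame_completion_of_chart`). [cite: Matsumura1987, Thm. 30.6] -/
theorem length_le_range_of_unramified [CharP L' 2] (hreg : ∀ m, IsRegularLocalRing (S m)) (hP : P.Monic)
    (hsep : (P.map (residue (S 0))).Separable) (hj : ∀ m, Function.Injective (j m))
    (k : Type) [Field k] [PerfectField k] [Algebra k L] (A : Subalgebra k L) (Q : Ideal A)
    (hA : A.FG) (hQ : Q.IsPrime) (hS : ∀ z : L, z ∈ S 0 ↔ ∃ a b : A, b ∉ Q ∧ z = (a : L) / (b : L)) (f₀ : S 0) :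
    haveI := isLocalRing_range (j 0)
    Module.length (AdicCompletion (maximalIdeal (j 0).range) (j 0).range) (AdicCompletion (maximalIdeal (j 0).range) (j 0).range ⧸
      Ideal.span (Set.range fun Dv : Derivation ℤ (AdicCompletion (maximalIdeal (j 0).range) (j 0).range)
        (AdicCompletion (maximalIdeal (j 0).range) (j 0).range) =>
        Dv (algebraMap (j 0).range (AdicCompletion (maximalIdeal (j 0).range) (j 0).range) (levelMap S hdom P ψ hψ θ hθ₀ j 0 f₀)))) ≤
      Module.length (AdicCompletion (maximalIdeal (S 0)) (S 0)) (AdicCompletion (maximalIdeal (S 0)) (S 0) ⧸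
        Ideal.span (Set.range fun Dv : Derivation ℤ (AdicCompletion (maximalIdeal (S 0)) (S 0)) (AdicCompletion (maximalIdeal (S 0)) (S 0)) =>
          Dv (algebraMap (S 0) (AdicCompletion (maximalIdeal (S 0)) (S 0)) f₀))) := by
  haveI := isLocalRing_range (j 0)
  haveI : IsRegularLocalRing (S 0) := hreg 0
  have hL := levelLift_j S hdom P ψ hψ θ hθ₀ j hjsucc hreg hP hsep hj 0
  haveI hreg' : IsRegularLocalRing (j 0).range := hL.2.2.2.2.2.1 (hreg 0)
  haveI : IsLocalHom (levelMap S hdom P ψ hψ θ hθ₀ j 0) := hL.1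
  -- the residue extension, finite separable, in the `toAlgebra` packaging of the last mile
  letI algS : Algebra (S 0) (j 0).range := (levelMap S hdom P ψ hψ θ hθ₀ j 0).toAlgebra
  haveI : IsLocalHom (algebraMap (S 0) (j 0).range) := hL.1
  obtain ⟨hfin, hsep'⟩ := finite_isSeparable_residueField_range S hdom P ψ hψ θ hθ₀ j hjsucc hreg hP hsep hj 0
  haveI := hfin; haveI := hsep'
  obtain ⟨hfin', hsep''⟩ := residueField_finite_isSeparable_toAlgebra (R := S 0) (S' := (j 0).range)
  -- the dual 2-frame of `κ(Ŝ₀)` from the geometric chart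
  have hfr := GeomTwoBasis.exists_pFrame_completion_of_chart k L A Q (S 0) hA hQ hS
  exact JacobianLength.length_quotient_span_derivation_le_of_unramified (levelMap S hdom P ψ hψ θ hθ₀ j 0) hL.2.1 hL.2.2.2.2.2.2.1
    hfin' hsep'' hfr f₀

include hjsucc in
/-- **The horizon base change read through embeddings `jₘ : Tₘ → L′`** (compatible, injective): all clauses of the K3ᴳ continuation for the chain
`S′ m := range jₘ`, unconditionally. [cite: StacksProject, Tag 00TV] -/
theorem horizon_cont_of_embeddings_holds
    (k : Type) [Field k] [PerfectField k] [Algebra k L] (hle : ∀ m, S m ≤ S (m + 1)) (f g : ∀ m, S m) (x : ∀ m, S (m + 1))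
    (hgeom : ∀ m, ∃ (A : Subalgebra k L) (Q : Ideal A), A.FG ∧ Q.IsPrime ∧ (∃ Q' : Ideal A, Q'.IsPrime ∧ Q < Q') ∧
      ∀ z : L, z ∈ S m ↔ ∃ a b : A, b ∉ Q ∧ z = (a : L) / (b : L))
    (hreg : ∀ m, IsRegularLocalRing (S m)) (hexc : ∀ m, IsExcellentRing (S m)) (hdim : ∀ m, ringKrullDim (S m) = (3 : ℕ))
    (hqt : ∀ m, IsQuadraticTransform (S m) (S (m + 1)))
    (hx : ∀ m, Ideal.span ((fun y : S m => (⟨(y : L), hle m y.2⟩ : S (m + 1))) '' (maximalIdeal (S m) : Set (S m))) = Ideal.span {x m})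
    (hlaw : ∀ m, ((f (m + 1) : S (m + 1)) : L) * ((x m : S (m + 1)) : L) ^ (2 * 2) = ((f m : S m) : L) - ((g m : S m) : L) ^ 2)
    (hiso : ∀ m, HasIsolatedSingularity (RadicandRing (S m) 2 (f m)))
    (hP : P.Monic) (hsep : (P.map (residue (S 0))).Separable) (hj : ∀ m, Function.Injective (j m)) (M : ℕ)
    (hcoeff : ∀ m, m < M → ∀ c : S (m + 1), ∃ q : (S 0)[X], ψ (m + 1) (residue (S (m + 1)) c) = q.eval₂ ((ψ 0).comp (residue (S 0))) θ)
    (C : Prop)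
    (cont : (∀ (L' : Type) [Field L'] [CharP L' 2] (S' : ℕ → Subring L') [∀ m, IsLocalRing (S' m)] [∀ m, IsNoetherianRing (S' m)]
          (hle' : ∀ m, S' m ≤ S' (m + 1)) (f' g' : ∀ m, S' m) (x' : ∀ m, S' (m + 1)),
          (∀ m, IsRegularLocalRing (S' m)) → (∀ m, IsExcellentRing (S' m)) → (∀ m, ringKrullDim (S' m) = (3 : ℕ)) →
          (∀ m, IsQuadraticTransform (S' m) (S' (m + 1))) →
          (∀ m, Ideal.span ((fun y : S' m => (⟨(y : L'), hle' m y.2⟩ : S' (m + 1))) '' (maximalIdeal (S' m) : Set (S' m)))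
              = Ideal.span {x' m}) →
          (∀ m, ((f' (m + 1) : S' (m + 1)) : L') * ((x' m : S' (m + 1)) : L') ^ (2 * 2) =
              ((f' m : S' m) : L') - ((g' m : S' m) : L') ^ 2) →
          (∀ m, HasIsolatedSingularity (RadicandRing (S' m) 2 (f' m))) →
          (∀ m, m < M → ∀ z : S' (m + 1), ∃ s : S' m, z - ⟨(s : L'), hle' m s.2⟩ ∈ maximalIdeal (S' (m + 1))) →
          (∀ m, ∃ (r : ℕ) (b : Fin r → ResidueField (S' m)), TwoBasis.IsTwoBasis b) →
          (∃ (r : ℕ) (γ : Fin r → ResidueField (AdicCompletion (maximalIdeal (S' 0)) (S' 0)))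
            (D : Fin r → Derivation ℤ (ResidueField (AdicCompletion (maximalIdeal (S' 0)) (S' 0)))
              (ResidueField (AdicCompletion (maximalIdeal (S' 0)) (S' 0)))),
            TwoBasis.IsTwoBasis γ ∧ ∀ l l', D l (γ l') = if l' = l then 1 else 0) →
          Module.length (AdicCompletion (maximalIdeal (S' 0)) (S' 0)) (AdicCompletion (maximalIdeal (S' 0)) (S' 0) ⧸
              Ideal.span (Set.range fun Dv : Derivation ℤ (AdicCompletion (maximalIdeal (S' 0)) (S' 0)) (AdicCompletion (maximalIdeal (S' 0)) (S' 0)) =>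
                Dv (algebraMap (S' 0) (AdicCompletion (maximalIdeal (S' 0)) (S' 0)) (f' 0)))) ≤
            Module.length (AdicCompletion (maximalIdeal (S 0)) (S 0)) (AdicCompletion (maximalIdeal (S 0)) (S 0) ⧸
              Ideal.span (Set.range fun Dv : Derivation ℤ (AdicCompletion (maximalIdeal (S 0)) (S 0)) (AdicCompletion (maximalIdeal (S 0)) (S 0)) =>
                Dv (algebraMap (S 0) (AdicCompletion (maximalIdeal (S 0)) (S 0)) (f 0)))) →
          C)) : C := by
  classical
  haveI : Fact (Nat.Prime 2) := ⟨Nat.prime_two⟩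
  haveI : ∀ m, IsRegularLocalRing (S m) := hreg
  haveI hl : ∀ m, IsLocalRing (j m).range := fun m => isLocalRing_range _
  have hL := fun m => levelLift_j S hdom P ψ hψ θ hθ₀ j hjsucc hreg hP hsep hj m
  have hle' : ∀ m, (j m).range ≤ (j (m + 1)).range := range_j_le S hdom P ψ hψ θ hθ₀ j hjsucc
  have hdom' : ∀ m, SubringDominates (j m).range (j (m + 1)).range := dominates_range_j S hdom P ψ hψ θ hθ₀ j hjsucc hj
  have hsq : ∀ m (s : S m), ((levelMap S hdom P ψ hψ θ hθ₀ j (m + 1) (Subring.inclusion (hdom m).1 s) : (j (m + 1)).range) : L') =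
      ((levelMap S hdom P ψ hψ θ hθ₀ j m s : (j m).range) : L') :=
    fun m s => j_algebraMap_inclusion S hdom P ψ hψ θ hθ₀ j hjsucc m s
  haveI hreg' : ∀ m, IsRegularLocalRing (j m).range := fun m => (hL m).2.2.2.2.2.1 (hreg m)
  haveI : ∀ m, IsNoetherianRing (j m).range := fun m => inferInstance
  -- `char L′ = 2`
  haveI : CharP L' 2 :=
    charP_of_injective_ringHom (f := (j 0).range.subtype.comp (levelMap S hdom P ψ hψ θ hθ₀ j 0))
      (Subtype.val_injective.comp (injective_of_levelLift (hL 0))) 2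
  -- ### the data upstairs
  let f' : ∀ m, (j m).range := fun m => levelMap S hdom P ψ hψ θ hθ₀ j m (f m)
  let g' : ∀ m, (j m).range := fun m => levelMap S hdom P ψ hψ θ hθ₀ j m (g m)
  let x' : ∀ m, (j (m + 1)).range := fun m => levelMap S hdom P ψ hψ θ hθ₀ j (m + 1) (x m)
  have hexc' : ∀ m, IsExcellentRing (j m).range := fun m => (hL m).2.2.2.2.2.2.2.1 (hexc m)
  have hdim' : ∀ m, ringKrullDim (j m).range = (3 : ℕ) := fun m => (hL m).2.2.2.2.2.2.1.trans (hdim m)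
  have hqt' : ∀ m, IsQuadraticTransform (j m).range (j (m + 1)).range := fun m =>
    isQuadraticTransform_of_levelLift (hqt m) (hle m) (hle' m) (hL m) (hL (m + 1)) (hsq m) (hdom' m)
  have hx' : ∀ m, Ideal.span ((fun y : (j m).range => (⟨(y : L'), hle' m y.2⟩ : (j (m + 1)).range)) ''
      (maximalIdeal (j m).range : Set (j m).range)) = Ideal.span {x' m} := fun m =>
    span_image_maximalIdeal_of_levelLift (hle m) (hle' m) (levelMap S hdom P ψ hψ θ hθ₀ j (m + 1)) (hL m) (hsq m) (x m) (hx m)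
  have hlaw' : ∀ m, ((f' (m + 1) : (j (m + 1)).range) : L') * ((x' m : (j (m + 1)).range) : L') ^ (2 * 2) =
      ((f' m : (j m).range) : L') - ((g' m : (j m).range) : L') ^ 2 := fun m =>
    law_lift (hle m) (levelMap S hdom P ψ hψ θ hθ₀ j m) (levelMap S hdom P ψ hψ θ hθ₀ j (m + 1)) (hsq m) (f m) (g m) (f (m + 1)) (x m) (2 * 2) (hlaw m)
  have hiso' : ∀ m, HasIsolatedSingularity (RadicandRing (j m).range 2 (f' m)) := fun m => (hL m).2.2.2.2.2.2.2.2.2 (f m) (hiso m)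
  have hrat' : ∀ m, m < M → ∀ z : (j (m + 1)).range, ∃ s : (j m).range,
      z - ⟨(s : L'), hle' m s.2⟩ ∈ maximalIdeal (j (m + 1)).range :=
    fun m hm => isResiduallyRational_range_j S hdom P ψ hψ θ hθ₀ j hjsucc hP hj m (hcoeff m hm)
  -- ### finite 2-bases upstairs, the dual 2-frame of `κ(Ŝ′₀)`, the ℓ-comparison
  have hB' : ∀ m, ∃ (r : ℕ) (b : Fin r → ResidueField (j m).range), TwoBasis.IsTwoBasis b := fun m => by
    obtain ⟨A, Q, hA, hQ, -, hS⟩ := hgeom m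
    exact exists_twoBasis_residueField_range S hdom P ψ hψ θ hθ₀ j hjsucc hreg hP hsep hj k m A Q hA hQ hS
  have hBhat' : ∃ (r : ℕ) (γ : Fin r → ResidueField (AdicCompletion (maximalIdeal (j 0).range) (j 0).range))
      (D : Fin r → Derivation ℤ (ResidueField (AdicCompletion (maximalIdeal (j 0).range) (j 0).range))
        (ResidueField (AdicCompletion (maximalIdeal (j 0).range) (j 0).range))),
      TwoBasis.IsTwoBasis γ ∧ ∀ l l', D l (γ l') = if l' = l then 1 else 0 := by
    obtain ⟨A, Q, hA, hQ, -, hS⟩ := hgeom 0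
    exact exists_pFrame_completion_range S hdom P ψ hψ θ hθ₀ j hjsucc hreg hP hsep hj k A Q hA hQ hS
  obtain ⟨A₀, Q₀, hA₀, hQ₀, -, hS₀⟩ := hgeom 0
  have hcmp := length_le_range_of_unramified S hdom P ψ hψ θ hθ₀ j hjsucc hreg hP hsep hj k A₀ Q₀ hA₀ hQ₀ hS₀ (f 0)
  exact cont L' (fun m => (j m).range) hle' f' g' x' hreg' hexc' hdim' hqt' hx' hlaw' hiso' hrat' hB' hBhat' hcmp

end Levels

/-! ## The horizon base change -/

/-- **K3ᴳ — the HORIZON BASE CHANGE for the geometric chain at `d = 4`** = the body of `K3GTarget.horizonBaseChange` = the `hK3G` binder of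
`GeomAssembly.geomChain_false_two_of_pieces` / `geomChain_false_of_pieces_all` (p564413), UNCONDITIONAL: for every horizon `M`, ONE finite étale `S 0`-algebra
`S 0[X]/(P)` (a primitive element of the finite separable `κ(S (M+1))/κ(S 0)`) base-changes the WHOLE chain, read in `L′ := Frac (lim Tₘ)`.
[cite: StacksProject, Tag 00TV] -/
theorem horizonBaseChange :
    ∀ (k L : Type) [Field k] [PerfectField k] [Field L] [CharP L 2] [Algebra k L]
      (S : ℕ → Subring L) [∀ m, IsLocalRing (S m)]
      (hle : ∀ m, S m ≤ S (m + 1)) (f g : ∀ m, S m) (x : ∀ m, S (m + 1)),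
      (∀ m, ∃ (A : Subalgebra k L) (Q : Ideal A), A.FG ∧ Q.IsPrime ∧ (∃ Q' : Ideal A, Q'.IsPrime ∧ Q < Q') ∧
        ∀ z : L, z ∈ S m ↔ ∃ a b : A, b ∉ Q ∧ z = (a : L) / (b : L)) →
      (∀ m, IsRegularLocalRing (S m)) → (∀ m, IsExcellentRing (S m)) → (∀ m, ringKrullDim (S m) = (3 : ℕ)) →
      (∀ m, IsQuadraticTransform (S m) (S (m + 1))) →
      (∀ m, Ideal.span ((fun y : S m => (⟨(y : L), hle m y.2⟩ : S (m + 1))) '' (maximalIdeal (S m) : Set (S m)))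
          = Ideal.span {x m}) →
      (∀ m, ((f (m + 1) : S (m + 1)) : L) * ((x m : S (m + 1)) : L) ^ (2 * 2) =
          ((f m : S m) : L) - ((g m : S m) : L) ^ 2) →
      (∀ m, HasIsolatedSingularity (RadicandRing (S m) 2 (f m))) →
      (∀ m, (∀ z : S (m + 1), ∃ s : S m, z - ⟨(s : L), hle m s.2⟩ ∈ maximalIdeal (S (m + 1))) ∨
        ∃ u : Fin 3 → S (m + 1),
          (∀ a : Fin 3 → S m, (∑ i, (⟨((a i : S m) : L), hle m (a i).2⟩ : S (m + 1)) * u i) ∈ maximalIdeal (S (m + 1)) →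
            ∀ i, a i ∈ maximalIdeal (S m)) ∧
          (∀ z : S (m + 1), ∃ a : Fin 3 → S m, z - ∑ i, (⟨((a i : S m) : L), hle m (a i).2⟩ : S (m + 1)) * u i ∈ maximalIdeal (S (m + 1)))) →
      ∀ (M : ℕ) (C : Prop),
        (∀ (L' : Type) [Field L'] [CharP L' 2] (S' : ℕ → Subring L') [∀ m, IsLocalRing (S' m)] [∀ m, IsNoetherianRing (S' m)]
          (hle' : ∀ m, S' m ≤ S' (m + 1)) (f' g' : ∀ m, S' m) (x' : ∀ m, S' (m + 1)),
          (∀ m, IsRegularLocalRing (S' m)) → (∀ m, IsExcellentRing (S' m)) → (∀ m, ringKrullDim (S' m) = (3 : ℕ)) →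
          (∀ m, IsQuadraticTransform (S' m) (S' (m + 1))) →
          (∀ m, Ideal.span ((fun y : S' m => (⟨(y : L'), hle' m y.2⟩ : S' (m + 1))) '' (maximalIdeal (S' m) : Set (S' m)))
              = Ideal.span {x' m}) →
          (∀ m, ((f' (m + 1) : S' (m + 1)) : L') * ((x' m : S' (m + 1)) : L') ^ (2 * 2) =
              ((f' m : S' m) : L') - ((g' m : S' m) : L') ^ 2) →
          (∀ m, HasIsolatedSingularity (RadicandRing (S' m) 2 (f' m))) →
          (∀ m, m < M → ∀ z : S' (m + 1), ∃ s : S' m, z - ⟨(s : L'), hle' m s.2⟩ ∈ maximalIdeal (S' (m + 1))) →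
          (∀ m, ∃ (r : ℕ) (b : Fin r → ResidueField (S' m)), TwoBasis.IsTwoBasis b) →
          (∃ (r : ℕ) (γ : Fin r → ResidueField (AdicCompletion (maximalIdeal (S' 0)) (S' 0)))
            (D : Fin r → Derivation ℤ (ResidueField (AdicCompletion (maximalIdeal (S' 0)) (S' 0)))
              (ResidueField (AdicCompletion (maximalIdeal (S' 0)) (S' 0)))),
            TwoBasis.IsTwoBasis γ ∧ ∀ l l', D l (γ l') = if l' = l then 1 else 0) →
          Module.length (AdicCompletion (maximalIdeal (S' 0)) (S' 0)) (AdicCompletion (maximalIdeal (S' 0)) (S' 0) ⧸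
              Ideal.span (Set.range fun Dv : Derivation ℤ (AdicCompletion (maximalIdeal (S' 0)) (S' 0)) (AdicCompletion (maximalIdeal (S' 0)) (S' 0)) =>
                Dv (algebraMap (S' 0) (AdicCompletion (maximalIdeal (S' 0)) (S' 0)) (f' 0)))) ≤
            Module.length (AdicCompletion (maximalIdeal (S 0)) (S 0)) (AdicCompletion (maximalIdeal (S 0)) (S 0) ⧸
              Ideal.span (Set.range fun Dv : Derivation ℤ (AdicCompletion (maximalIdeal (S 0)) (S 0)) (AdicCompletion (maximalIdeal (S 0)) (S 0)) =>
                Dv (algebraMap (S 0) (AdicCompletion (maximalIdeal (S 0)) (S 0)) (f 0)))) →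
          C) → C := by
  intro k L _ _ _ _ _ S _ hle f g x hgeom hreg hexc hdim hqt hx hlaw hiso hstep M C cont
  have hdom : ∀ m, SubringDominates (S m) (S (m + 1)) := fun m => (hqt m).dominates
  obtain ⟨k', _instk', ψ, hψ, P, θ, hP, hsep, hθ₀, hcoeff⟩ := exists_compat_root S hle hdom hstep M
  haveI := isDomain_LimT S hdom P ψ hψ θ hθ₀ hreg hP hsep
  exact horizon_cont_of_embeddings_holds S hdom P ψ hψ θ hθ₀ (jT S hdom P ψ hψ θ hθ₀) (jT_comp_gT S hdom P ψ hψ θ hθ₀) k hle f g x hgeom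
    hreg hexc hdim hqt hx hlaw hiso hP hsep (injective_jT S hdom P ψ hψ θ hθ₀ hreg hP hsep) M hcoeff C cont

end Summit.ResolutionOfSingularities.ResolutionOfSingularities.Theorems.SwitchingDichotomy.EtaleTower

end
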